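import Summits.ResolutionOfSingularities.ResolutionOfSingularities.Theorems.FrobeniusClosingPatchingRelPerfectLetterTowerTwoNontrivial
import HarnessLib

/-!
# Crux `PatchingRelPerfect` (stmt-ResolutionOfSingularities-16161), chain w52 — rung toolkit:
# the two-letter tower with NO hypothesis on the centre quotient beyond regularity

[OURS · L1 W5.2 · rung tool] `…LetterTowerTwoNontrivial` assumes `R/(c, ℓ)` regular and nontrivial.
If `R/(c, ℓ)` is trivial then `(c, ℓ) = R`, every flag factor `(c, L 0 ⋯ L s)` is the unit ideal
(`letterTower_two_top`) and the blowing up is an isomorphism; hence (PLAN-A2-certificate.md,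
addendum 6 (β)) the hypothesis can be dropped: `isRegular_of_isBlowup_letterTower_two''` — `R` a
regular domain, `(c, ℓ)` quasi-regular, `R/(c, ℓ)` regular, `ℓ ≠ 0`, letters in `{ℓ, 1}`.  This is
the form consumed by the side charts `V(u, F♯) ⊂ B_i`, `i ≤ 2`, of the contact-migration member,
where exactly `isRegularRing_quot_span_u_F_*` is in the tree.  Nothing here is a statement of the
manuscript under review.

## References

* The Stacks Project, Tags 080A, 080B, 0804, 0BIQ. [StacksProject]
* Q. Liu, *Algebraic Geometry and Arithmetic Curves*, OUP 2002, Thm. 8.1.19 (a). [Liu2002]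
-/

-- `Summit.<Summit>.<Sub>.Theorems` with `Sub = Summit` (single-conjunct summit, D-0017)
set_option linter.dupNamespace false

noncomputable section

open CategoryTheory CategoryTheory.Limits AlgebraicGeometry Literature.AlgebraicGeometry.Resolution
open IsLocalRing

namespace Summit.ResolutionOfSingularities.ResolutionOfSingularities.Theorems

namespace ConeRung

universe u

/-- If `(c, ℓ) = R` then `(c, L 0 ⋯ L (n-1)) = R` for letters `L r ∈ {ℓ, 1}`. [folklore] -/
theorem span_pair_prod_letters_eq_top {R : Type*} [CommRing R] (c ℓ : R) (L : ℕ → R)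
    (hL : ∀ r, L r = ℓ ∨ L r = 1) (htop : Ideal.span {c, ℓ} = ⊤) (n : ℕ) :
    Ideal.span {c, ∏ r ∈ Finset.range n, L r} = ⊤ := by
  induction n with
  | zero =>
    rw [Finset.prod_range_zero, Ideal.span_insert, Ideal.span_singleton_one, sup_top_eq]
  | succ n ih =>
    rw [Ideal.span_insert] at ih htop ⊢
    rw [Finset.prod_range_succ, ← Ideal.span_singleton_mul_span_singleton,
      Ideal.sup_mul_eq_of_coprime_left ih]
    rcases hL n with h | h
    · rw [h, htop]
    · rw [h, Ideal.span_singleton_one, sup_top_eq]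

/-- **The flag product is the unit ideal when `(c, ℓ) = R`**. [folklore] -/
theorem letterTower_two_top {R : Type*} [CommRing R] (c ℓ : R) (L : ℕ → R)
    (hL : ∀ r, L r = ℓ ∨ L r = 1) (htop : Ideal.span {c, ℓ} = ⊤) (N : ℕ) :
    ∏ s ∈ Finset.range N, Ideal.span {c, ∏ r ∈ Finset.range (s + 1), L r} = ⊤ := by
  rw [← Ideal.one_eq_top]
  refine Finset.prod_eq_one fun s _ => ?_
  rw [Ideal.one_eq_top]
  exact span_pair_prod_letters_eq_top c ℓ L hL htop (s + 1)

/-- **The two-letter tower with repeats is regular — no hypothesis on `R/(c, ℓ)` beyond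
regularity.**  `R` a regular domain, `(c, ℓ)` quasi-regular, `R/(c, ℓ)` regular, `ℓ ≠ 0`,
`L r ∈ {ℓ, 1}`: every blowing up of `Spec R` along `∏_{s<N} (c, L 0 ⋯ L s)` is regular.
[cite: StacksProject, Tag 080A] [cite: StacksProject, Tag 080B] [cite: Liu2002, Thm. 8.1.19 (a)] -/
theorem isRegular_of_isBlowup_letterTower_two'' (N : ℕ) {R : Type u} [CommRing R] [IsRegularRing R]
    [IsDomain R] (c ℓ : R) (L : ℕ → R) (hL : ∀ r, L r = ℓ ∨ L r = 1)
    (hcl : IsQuasiRegular (Fin.cons c (fun _ : Fin 1 => ℓ) : Fin 2 → R))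
    (hRl : IsRegularRing (R ⧸ Ideal.span {c, ℓ})) (hℓ0 : ℓ ≠ 0)
    {Y : Scheme.{u}} {f : Y ⟶ Spec (.of R)}
    (hf : IsBlowup f (affineBlowup.idealSheaf (∏ s ∈ Finset.range N,
      Ideal.span {c, ∏ r ∈ Finset.range (s + 1), L r}))) :
    Scheme.IsRegular Y := by
  rcases subsingleton_or_nontrivial (R ⧸ Ideal.span {c, ℓ}) with h | h
  · have htop : Ideal.span {c, ℓ} = ⊤ := Ideal.Quotient.subsingleton_iff.mp h
    rw [letterTower_two_top c ℓ L hL htop N, affineBlowup.idealSheaf_top] at hf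
    haveI : IsIso f := hf.isIso isEffectiveCartier_top
    haveI : IsRegularRing (CommRingCat.of R) := inferInstanceAs (IsRegularRing R)
    exact SectionAscent.TraceIdeal.isRegular_of_iso (asIso f) (Scheme.isRegular_Spec _)
  · exact isRegular_of_isBlowup_letterTower_two' N c ℓ L hL hcl h hRl hℓ0 hf

end ConeRung

end Summit.ResolutionOfSingularities.ResolutionOfSingularities.Theorems

end
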